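import Summits.SmoothPoincare4.SmoothPoincare4.Theorems.ConvexBisectionAcyclicBisectionExistsHgapCharacter
import Summits.SmoothPoincare4.SmoothPoincare4.Theorems.ConvexBisectionAcyclicBisectionExistsHgapTransport
import Summits.SmoothPoincare4.SmoothPoincare4.Theorems.ConvexBisectionAcyclicBisectionExistsT3AssemblyClosedN0
import HarnessLib

/-!
# Dual handles, node `Hgap`: the assembly from G1's fibred transport and G2's twisting number
(sub-goal of stub `stub_T3_dualPresentation` (T3) ▸ node `Hgap` ▸ part C (assembly), line `modp-braid-orbits`,
crux `ConvexBisection.AcyclicBisectionExists`, item stmt-SmoothPoincare4-10508; wave 6, lead c5, worker G3;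
registered sub-goal `helper_exists_depth_bound`)

The node `Hgap` ("T3c-3 WITH DATA", 2nd hypothesis of `T3_of_two_pieces`, `…T3AssemblyClosed.lean`; with
`hN0` added: `Hgap'`, 2nd hypothesis of G1's `T3_of_two_pieces_N0`, `…T3AssemblyClosedN0.lean`) from its
three parts:
* (A) G1's LANDED `Hgap_transport` (`…HgapTransport.lean`): the dual data `D₂` transported along the
  time-`1` map of the universal straightening `S = strIso g m hm` — flat pages, shadows `≠ 0`, the bridges
  (R1p) (R2p), the `jA`-formula `D₂p.jA = D₂.jA ∘ S_(-1)`;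
* (B) G2's twisting number, HYPOTHESIS `HB` (text = G2's `HBStatement`, `work/stubs/G2G3_interface.lean` V1):
  `pageTwisting (S_1 ∘ β_j, dS_1 fr_j) = -s₀ · t_j` for X3's global twisting sign `s₀`;
* (C) the orientation character (`Hgap_character`, `…HgapCharacter.lean`): `Hχ` holds with the SAME `s₀`
  (`= twistSign` at the seam base point) — THE COUPLING: with `s := (s₀ = 1)` the twisting clause reads
  `if s then -1 else 1 = -s₀` (negative letters, `t_j = 1`) and `Hχ(s)` reads `0 < s₀ · det4 (…)`; both hold.

FINDINGS recorded in the statement proved here (`HgapK_of_HB`), which is `Hgap'` with TWO MORE hypotheses: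
* `(hNs : ∀ x ∈ N, x.2 = false)`: by (B) the page twisting of the `j`-th transported dual handle is
  `-s₀ · t_j`, `t_j = if (N.get j).2 then -1 else 1`, so ONE Bool `s` for all `j` needs the letters of `N`
  to have one sign (T3 has `hNs` in context);
* `∃ κ₁ > 0` right after `hlink` and `(hκK : κ ≤ κ₁)`: the seam clause `hseam` is available only over base
  points whose suffix-tube preimages are SHALLOW (`‖t_λ‖² ≤ 1 - 3κ²/4`, Y5's unmoved zone), and `Hχ` needs
  it on a NEIGHBOURHOOD of a FLAT seam point off the cores; for a fixed flat point `q` off the cores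
  (`helper_exists_mem_page_coresComplement`) the finitely many tube preimages have depth `< 1`
  (`exists_depth_bound`, §1), so `q` is strictly shallow once `κ ≤ κ₁(q)`, and strict shallowness is an open
  condition (§2, the deep set is compact).  Without the margin the existence of such a point for every
  `κ ≤ 1` is a statement about the complement of a solid torus in `∂ Base g` (true, but not in reach).
The amended contract `T3_of_two_pieces_K (HST4) (HgapK)` is `…T3AssemblyClosedK.lean` (G3).

Everything here is proved from `HB`; no `sorry`.

## References
* R. İ. Baykur, *Kähler decomposition of 4-manifolds*, AGT 6 (2006), proof of Thm. 5.1. [Baykur2006]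
* J. B. Etnyre, T. Fuller, *Realizing 4-manifolds as achiral Lefschetz fibrations*, IMRN 2006, Thm. 1. [EtnyreFuller2006]
* A. A. Kosinski, *Differential Manifolds* (1993), VI §6. [Kosinski1993]
-/

noncomputable section

-- the prescribed namespace `Summit.<P>.<Sub>.…` duplicates `SmoothPoincare4` (P = Sub)
set_option linter.dupNamespace false

open scoped Manifold ContDiff Topology

namespace Summit.SmoothPoincare4.SmoothPoincare4.Theorems.AcyclicBisectionExists.ModpBraidOrbits

open Set Function Metric Filter
open Literature.Topology.FourManifolds Literature.Topology.FourManifolds.HandleAttachingMap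
  Literature.Topology.FourManifolds.BoundaryManifold Literature.Topology.FourManifolds.LefschetzBase
  Literature.Geometry.Symplectic

variable {g : ℕ}

/-! ## §1 Depth of the tube preimages of a point off the cores -/

/-- **A point off the cores has tube preimages of depth bounded away from `1`.**  For a finite family of
attaching maps `q` and `a` off all cores `qᵢ(S)`, there is `0 ≤ M < 1` with `‖t_λ‖² ≤ M` for every tube point
`t` with `qᵢ t = a` (each `qᵢ` is injective, so there are finitely many such `t`, none on the attaching
sphere `‖t_λ‖² = 1`). [cite: Kosinski1993, VI §6] -/
theorem exists_depth_bound {ι : Type} [Finite ι] (q : ι → HandleAttachingMap 3 2 (Base g)) {a : Base g}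
    (ha : a ∈ coresComplement q) :
    ∃ M : ℝ, 0 ≤ M ∧ M < 1 ∧ ∀ (i : ι) (t : ↥(handleTube 3 2)), (q i).toFun t = a →
      lamSq 2 ((t : closedBall (0 : EuclideanSpace ℝ (Fin 4)) 1) : EuclideanSpace ℝ (Fin 4)) ≤ M := by
  classical
  -- the depth of the (unique) `qᵢ`-preimage of `a`, `0` if there is none
  set f : ι → ℝ := fun i => if hi : ∃ t : ↥(handleTube 3 2), (q i).toFun t = a then
    lamSq 2 ((hi.choose : closedBall (0 : EuclideanSpace ℝ (Fin 4)) 1) : EuclideanSpace ℝ (Fin 4)) else 0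
    with hf
  have hf0 : ∀ i, 0 ≤ f i := fun i => by
    simp only [hf]
    split_ifs
    · exact lamSq_nonneg _ _
    · exact le_rfl
  have hf1 : ∀ i, f i < 1 := fun i => by
    simp only [hf]
    split_ifs with hi
    · have ht := hi.choose_spec
      have hle : lamSq 2 ((hi.choose : closedBall (0 : EuclideanSpace ℝ (Fin 4)) 1) : EuclideanSpace ℝ (Fin 4)) ≤ 1 :=
        lamSq_le_one (mem_closedBall_zero_iff.1 hi.choose.1.2)
      refine lt_of_le_of_ne hle fun h1 => ?_
      have hcore : a ∈ (q i).core := (mem_core_iff (q i)).2 ⟨hi.choose, h1, ht⟩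
      exact ((mem_coresComplement q).1 ha i) hcore
    · exact zero_lt_one
  have hfle : ∀ (i : ι) (t : ↥(handleTube 3 2)), (q i).toFun t = a →
      lamSq 2 ((t : closedBall (0 : EuclideanSpace ℝ (Fin 4)) 1) : EuclideanSpace ℝ (Fin 4)) ≤ f i := by
    intro i t ht
    have hi : ∃ t : ↥(handleTube 3 2), (q i).toFun t = a := ⟨t, ht⟩
    have heq : hi.choose = t := (q i).injective (hi.choose_spec.trans ht.symm)
    simp only [hf, dif_pos hi]
    rw [heq]
  cases isEmpty_or_nonempty ι with
  | inl hι => exact ⟨0, le_rfl, zero_lt_one, fun i => (IsEmpty.false i).elim⟩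
  | inr hι =>
    obtain ⟨i₀, hi₀⟩ := Finite.exists_max f
    exact ⟨f i₀, hf0 i₀, hf1 i₀, fun i t ht => (hfle i t ht).trans (hi₀ i)⟩

/-! ## §2 Strict shallowness is open (X1's `isClosed_deepSet`) -/

/-- **Strict shallowness is an open condition**: if every tube preimage of `a` has depth `≤ M < c`, then
every point near `a` has all its tube preimages of depth `< c`. [folklore] -/
theorem eventually_shallow {ι : Type} [Finite ι] (q : ι → HandleAttachingMap 3 2 (Base g)) {a : Base g}
    {M c : ℝ} (hc : 0 < c) (hMc : M < c)
    (hM : ∀ (i : ι) (t : ↥(handleTube 3 2)), (q i).toFun t = a →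
      lamSq 2 ((t : closedBall (0 : EuclideanSpace ℝ (Fin 4)) 1) : EuclideanSpace ℝ (Fin 4)) ≤ M) :
    ∀ᶠ a' in 𝓝 a, ∀ (i : ι) (t : ↥(handleTube 3 2)), (q i).toFun t = a' →
      lamSq 2 ((t : closedBall (0 : EuclideanSpace ℝ (Fin 4)) 1) : EuclideanSpace ℝ (Fin 4)) < c := by
  have hK := isClosed_deepSet q hc
  have ha : a ∉ {w : Base g | ∃ (i : ι) (t : ↥(handleTube 3 2)), (q i).toFun t = w ∧
      c ≤ lamSq 2 ((t : closedBall (0 : EuclideanSpace ℝ (Fin 4)) 1) : EuclideanSpace ℝ (Fin 4))} := by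
    rintro ⟨i, t, hta, ht⟩
    exact absurd ((hM i t hta).trans_lt hMc) (not_lt.2 ht)
  filter_upwards [hK.isOpen_compl.mem_nhds ha] with a' ha' i t hta
  by_contra hlt
  exact ha' ⟨i, t, hta, not_lt.1 hlt⟩

/-! ## §3 The global twisting sign read at one flat point off the cores -/

section Sign

variable {l : List ((Fin g ⊕ Fin g → ℤ) × Bool)} {h : Fin l.length → HandleAttachingMap 3 2 (Base g)}
  (hlink : IsLefschetzLink g l h)
  {X : Type} [TopologicalSpace X] [ChartedSpace (EuclideanHalfSpace 4) X] [IsManifold (𝓡∂ 4) ∞ X]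
  (D : MultiAttachmentData h (𝓡∂ 4) X) (bX : BoundaryData (𝓡∂ 4) X (𝓡 3)) [Nonempty bX.carrier]
  (Ψ : bX.carrier ≃ₘ⟮𝓡 3, 𝓡 3⟯ (bBase g).carrier)
  (hpage : ∀ (y : bX.carrier) (a : ↥(coresComplement h)), bX.incl y = D.jA a →
    ∃ c : ℝ, 0 < c ∧ w g ((bBase g).incl (Ψ y)).1 = (c : ℂ) * w g (a : Base g).1)

include hlink hpage in
-- adapted from `exists_twistSign_global` (…SeamTwistSignGlobal.lean, X3)
/-- **X3's global twisting sign is `twistSign y₁` for ANY flat point `y₁` off the cores**: the defining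
property of `s₀` in `helper_seam_twistSign_global` holds with `s₀ := twistSign D bX Ψ y₁`.
[cite: EtnyreFuller2006, Thm. 1 (proof, p. 8)] -/
theorem twistSign_global_at {y₁ : (bBase g).carrier} (hy₁ : (y₁.1 : Base g) ∈ coresComplement h)
    (hflat₁ : ‖cx y₁.1.1‖ ^ 2 < 4) (y : (bBase g).carrier) (hy : (y.1 : Base g) ∈ coresComplement h) (c : ℂ)
    (hc : ‖c‖ = 1) (hyc : y.1 ∈ page g c) (R : AmbientIsotopy (𝓡∂ 4) (Base g))
    (hρR : ∀ (t : ℝ) (x : Base g), rho g (R.toFun t x).1 = rho g x.1)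
    (hdirR : ∀ (t : ℝ) (x : Base g), ∃ r : ℝ, 0 < r ∧ w g (R.toFun t x).1 = (r : ℂ) * w g x.1)
    (hR1 : R.toFun 1 (seamB D bX Ψ y) ∈ page g c) :
    0 < (twistSign D bX Ψ y₁ : ℝ) * pageDet g (bdDeriv g (R.toFun 1 ∘ seamB D bX Ψ) y) y.1.1 := by
  have hflat : ‖cx y.1.1‖ ^ 2 < 4 := (flat_of_mem_page hc hyc).1
  rw [← twistSign_eq hlink D bX Ψ hpage hy hflat hy₁ hflat₁]
  obtain ⟨κ, hκ, hκe⟩ := pageDet_flatten_eq D bX Ψ hpage R hρR hdirR hy hc hyc hR1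
  have hne0 := twistDet_ne_zero D bX Ψ hpage hy hc hyc
  rw [hκe]
  unfold twistSign
  by_cases h0 : 0 < twistDet D bX Ψ y
  · rw [if_pos h0]; push_cast; positivity
  · rw [if_neg h0]; push_cast
    have : twistDet D bX Ψ y < 0 := lt_of_le_of_ne (not_lt.1 h0) hne0
    nlinarith

end Sign

/-! ## §4 The node with data, from (A) landed, (B) as hypothesis, (C) landed -/

set_option maxHeartbeats 800000 in
-- a telescope of ~60 binders with long dependent types (as in X2's `T3_of_pieces`)
/-- **The node `Hgap` WITH DATA from its parts** (G1's landed fibred transport `Hgap_transport`, G2's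
twisting number `HB` as hypothesis, the orientation character `Hgap_character`): the text `Hgap'` of
`T3_of_two_pieces_N0` with the two extra hypotheses `hNs` (letters of `N` negative) and `κ ≤ κ₁`
(`∃ κ₁ > 0` chosen from `g P N h hlink`: a flat seam point off the cores is strictly shallow for `κ ≤ κ₁`),
see the module docstring.  The Bool is `s := (twistSign = 1)`: twisting `-s₀`, character `s₀` — the
coupling of the two orientation clauses of T3. [cite: Baykur2006, Thm. 5.1 (proof, pp. 13–14)] -/
theorem HgapK_of_HB
    (HB : ∀ (g : ℕ) (l : List ((Fin g ⊕ Fin g → ℤ) × Bool)) (h : Fin l.length → HandleAttachingMap 3 2 (Base g)),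
    IsLefschetzLink g l h →
    ∀ {X : Type} [TopologicalSpace X] [T2Space X] [SecondCountableTopology X] [CompactSpace X]
      [ChartedSpace (EuclideanHalfSpace 4) X] [IsManifold (𝓡∂ 4) ∞ X]
      (D : MultiAttachmentData h (𝓡∂ 4) X) (bX : BoundaryData (𝓡∂ 4) X (𝓡 3)) [Nonempty bX.carrier]
      (Ψ : bX.carrier ≃ₘ⟮𝓡 3, 𝓡 3⟯ (bBase g).carrier),
      (∀ (y : bX.carrier) (a : ↥(coresComplement h)), bX.incl y = D.jA a →
        ∃ c : ℝ, 0 < c ∧ w g ((bBase g).incl (Ψ y)).1 = (c : ℂ) * w g (a : Base g).1) →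
    ∀ (s₀ : ℤ), (s₀ = 1 ∨ s₀ = -1) →
      (∀ (y : (bBase g).carrier) (_ : (y.1 : Base g) ∈ coresComplement h) (c : ℂ) (_ : ‖c‖ = 1)
        (_ : y.1 ∈ page g c) (R : AmbientIsotopy (𝓡∂ 4) (Base g))
        (_ : ∀ (t : ℝ) (x : Base g), rho g (R.toFun t x).1 = rho g x.1)
        (_ : ∀ (t : ℝ) (x : Base g), ∃ r : ℝ, 0 < r ∧ w g (R.toFun t x).1 = (r : ℂ) * w g x.1)
        (_ : R.toFun 1 (seamB D bX Ψ y) ∈ page g c),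
        0 < (s₀ : ℝ) * pageDet g (bdDeriv g (R.toFun 1 ∘ seamB D bX Ψ) y) y.1.1) →
    ∀ (col : (BoundaryManifold.boundaryData 3 (Base g)).Collar) (κ δ : ℝ) (hκ : 0 < κ) (hκ1 : κ ≤ 1)
      (hδ : 0 < δ) (hδ2 : δ ≤ 1 / 2) (j : Fin l.length) (c : ℂ) (_ : ‖c‖ = 1)
      (R : AmbientIsotopy (𝓡∂ 4) (Base g))
      (_ : ∀ (t : ℝ) (x : Base g), rho g (R.toFun t x).1 = rho g x.1)
      (_ : ∀ (t : ℝ) (x : Base g), ∃ r : ℝ, 0 < r ∧ w g (R.toFun t x).1 = (r : ℂ) * w g x.1)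
      (_ : ∀ θ, R.toFun 1 ((dualMap D bX (bBase g) Ψ col κ δ hκ hκ1 hδ hδ2 j).attachingCircle θ) ∈ page g c),
      pageTwisting g
          ((dualMap D bX (bBase g) Ψ col κ δ hκ hκ1 hδ hδ2 j).transport (R.toDiffeomorph 1)).attachingCircle
          ((dualMap D bX (bBase g) Ψ col κ δ hκ hκ1 hδ hδ2 j).transport (R.toDiffeomorph 1)).attachingFraming =
        -s₀ * (if (l.get j).2 then -1 else 1)) :
    ∀ (g : ℕ) (P N : List ((Fin g ⊕ Fin g → ℤ) × Bool)) (h : Fin (P ++ N).length → HandleAttachingMap 3 2 (Base g)) (hlink : IsLefschetzLink g (P ++ N) h), ∃ κ₁ : ℝ, 0 < κ₁ ∧ ∀ {X : Type} [TopologicalSpace X] [T2Space X] [SecondCountableTopology X] [CompactSpace X] [ChartedSpace (EuclideanHalfSpace 4) X] [IsManifold (𝓡∂ 4) ∞ X] (D : MultiAttachmentData h (𝓡∂ 4) X) (bX : BoundaryData (𝓡∂ 4) X (𝓡 3)) (Ψ : bX.carrier ≃ₘ⟮𝓡 3, 𝓡 3⟯ (bBase g).carrier) (hpage : ∀ (y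 : bX.carrier) (a : ↥(coresComplement h)), bX.incl y = D.jA a → ∃ c : ℝ, 0 < c ∧ w g ((bBase g).incl (Ψ y)).1 = (c : ℂ) * w g (a : Base g).1) {X₁ : Type} [TopologicalSpace X₁] [T2Space X₁] [SecondCountableTopology X₁] [CompactSpace X₁] [ChartedSpace (EuclideanHalfSpace 4) X₁] [IsManifold (𝓡∂ 4) ∞ X₁] (D₁ : MultiAttachmentData (fun i : Fin P.length => h (Fin.cast List.length_append.symm (Fin.castAdd N.length i))) (𝓡∂ 4) X₁) {W₂ : Type} [TopologicalSpace W₂] [T2Space W₂] [SecondCountableTopology W₂] [CompactSpace W₂] [ChartedSpace (EuclideanHalfSpace 4) W₂] [IsManifold (𝓡∂ 4) ∞ W₂] (b₂ : BoundaryData (𝓡∂ 4) W₂ (𝓡 3)) (φ : (BoundaryManifold.boundaryData 3 X₁).carrier ≃ₘ⟮𝓡 3, 𝓡 3⟯ b₂.carrier) (col : (BoundaryManifold.boundaryData 3 (Base g)).Collar) (κ δ : ℝ) (hκ : 0 < κ) (hκ1 : κ ≤ 1) (hδ : 0 < δ) (hδ2 : δ ≤ 1 / 2) (D₂ : MultiAttachmentData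 (fun j : Fin N.length => dualMap D bX (bBase g) Ψ col κ δ hκ hκ1 hδ hδ2 (Fin.cast List.length_append.symm (Fin.natAdd P.length j))) (𝓡∂ 4) W₂) (hseam : ∀ (y : (BoundaryManifold.boundaryData 3 X₁).carrier) (a : ↥(coresComplement h)) (ha₁ : (a : Base g) ∈ coresComplement (fun i : Fin P.length => h (Fin.cast List.length_append.symm (Fin.castAdd N.length i)))) (z : bX.carrier) (hz : D.jA a = bX.incl z), (BoundaryManifold.boundaryData 3 X₁).incl y = D₁.jA ⟨a, ha₁⟩ → (∀ (j : Fin N.length) (t : ↥(handleTube 3 2)), (h (Fin.cast List.length_append.symm (Fin.natAdd P.length j))).toFun t = (a : Base g) → ‖lamPart ((t : closedBall (0 : EuclideanSpace ℝ (Fin 4)) 1) : EuclideanSpace ℝ (Fin 4))‖ ^ 2 ≤ 1 - 3 * κ ^ 2 / 4) → b₂.incl (φ y) = D₂.jA ⟨(bBase g).incl (Ψ z), incl_mem_coresComplement_dualMap D bX (bBase g) Ψ col κ δ hκ hκ1 hδ hδ2 (fun j : Fin N.length => Fin.cast List.length_append.symm (Fin.natAdd P.length j)) z a hz⟩) (hN0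 : ∀ x ∈ N, x.1 ≠ 0) (hNs : ∀ x ∈ N, x.2 = false) (hκK : κ ≤ κ₁) (s' : Bool) (h' : Fin N.length → HandleAttachingMap 3 2 (Base g)) (_ : ∀ j, ∃ c : ℂ, ‖c‖ = 1 ∧ ∀ θ, (h' j).attachingCircle θ ∈ page g c) (_ : ∀ j, shadow g (h' j).attachingCircle (h' j).continuous_attachingCircle ≠ 0) (_ : ∀ j, pageTwisting g (h' j).attachingCircle (h' j).attachingFraming = if s' then -1 else 1) (_ : Pairwise fun i j => Disjoint (range (h' i).toFun) (range (h' j).toFun)) (_ : HandleAttachingMap.IsMultiAttachment h' (𝓡∂ 4) W₂), ∃ (q₂ : Fin N.length → HandleAttachingMap 3 2 (Base g)) (D₂p : MultiAttachmentData q₂ (𝓡∂ 4) W₂) (s : Bool), (∀ j, ∃ c : ℂ, ‖c‖ = 1 ∧ ∀ θ, (q₂ j).attachingCircle θ ∈ page g c) ∧ (∀ j, shadow g (q₂ j).attachingCircle (q₂ j).continuous_attachingCircle ≠ 0) ∧ (∀ j, pageTwisting g (q₂ j).attachingCircle (q₂ j).attachingFraming = if s then -1 else 1) ∧ (∃ (y₀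 : (BoundaryManifold.boundaryData 3 X₁).carrier) (a₁ : ↥(coresComplement (fun i : Fin P.length => h (Fin.cast List.length_append.symm (Fin.castAdd N.length i))))) (a₂ : ↥(coresComplement q₂)), (BoundaryManifold.boundaryData 3 X₁).incl y₀ = D₁.jA a₁ ∧ b₂.incl (φ y₀) = D₂p.jA a₂ ∧ ∀ (uu : Fin 3 → EuclideanSpace ℝ (Fin 3)) (v₁ v₂ : Fin 3 → EuclideanSpace ℝ (Fin 4)), (∀ k, mfderiv (𝓡 3) (𝓡∂ 4) (BoundaryManifold.boundaryData 3 X₁).incl y₀ (uu k) = mfderiv (𝓡∂ 4) (𝓡∂ 4) D₁.jA a₁ (v₁ k)) → (∀ k, mfderiv (𝓡 3) (𝓡∂ 4) (b₂.incl ∘ φ) y₀ (uu k) = mfderiv (𝓡∂ 4) (𝓡∂ 4) D₂p.jA a₂ (v₂ k)) → IsPosBdryFrame (fun i : Fin P.length => h (Fin.cast List.length_append.symm (Fin.castAdd N.length i))) a₁ v₁ → 0 < (if s then (1 : ℝ) else -1) * det4 (gradient (rho g) (a₂ : Base g).1) (ambientC q₂ a₂ (v₂ 0)) (ambientC q₂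 a₂ (v₂ 1)) (ambientC q₂ a₂ (v₂ 2))) ∧ (∀ ap : ↥(coresComplement q₂), ∃ (a' : ↥(coresComplement (fun j : Fin N.length => dualMap D bX (bBase g) Ψ col κ δ hκ hκ1 hδ hδ2 (Fin.cast List.length_append.symm (Fin.natAdd P.length j))))) (c : ℝ), 0 < c ∧ D₂p.jA ap = D₂.jA a' ∧ w g (ap : Base g).1 = (c : ℂ) * w g (a' : Base g).1) ∧ (∀ a' : ↥(coresComplement (fun j : Fin N.length => dualMap D bX (bBase g) Ψ col κ δ hκ hκ1 hδ hδ2 (Fin.cast List.length_append.symm (Fin.natAdd P.length j)))), ∃ ap : ↥(coresComplement q₂), D₂p.jA ap = D₂.jA a') := by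
  intro g P N h hlink
  classical
  -- the seam base point: a flat point of the page of direction `1` off the cores
  obtain ⟨q, hq1, hqc⟩ := helper_exists_mem_page_coresComplement g (P ++ N) h hlink 1 (by simp)
  have hqc' : q ∈ coresComplement h := hqc
  have hqN : q ∈ coresComplement (fun j : Fin N.length => h (Fin.cast List.length_append.symm (Fin.natAdd P.length j))) :=
    (mem_coresComplement _).2 fun j => (mem_coresComplement _).1 hqc' _
  have hqP : q ∈ coresComplement (fun i : Fin P.length => h (Fin.cast List.length_append.symm (Fin.castAdd N.length i))) :=
    (mem_coresComplement _).2 fun i => (mem_coresComplement _).1 hqc' _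
  obtain ⟨M, hM0, hM1, hM⟩ := exists_depth_bound
    (fun j : Fin N.length => h (Fin.cast List.length_append.symm (Fin.natAdd P.length j))) hqN
  refine ⟨(1 - M) / 2, by linarith, ?_⟩
  intro X _ _ _ _ _ _ D bX Ψ hpage X₁ _ _ _ _ _ _ D₁ W₂ _ _ _ _ _ _ b₂ φ col κ δ hκ hκ1 hδ hδ2 D₂ hseam hN0 hNs hκK
    s' h' _ _ _ _ _
  have hcM : M < 1 - 3 * κ ^ 2 / 4 := by nlinarith
  have hcpos : 0 < 1 - 3 * κ ^ 2 / 4 := by nlinarith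
  set y₁ : (bBase g).carrier := ⟨q, page_subset_boundary g (by simp) hq1⟩ with hy₁
  haveI : Nonempty bX.carrier := ⟨Ψ.symm y₁⟩
  have hflat : ‖cx y₁.1.1‖ ^ 2 < 4 := (flat_of_mem_page (by simp) hq1).1
  -- (A) G1: the transported dual data
  obtain ⟨m, hm, D₂p, -, hjA, -, hpages, hshadows, R1p, R2p⟩ :=
    Hgap_transport g P N h hlink D bX Ψ hpage col κ δ hκ hκ1 hδ hδ2 D₂ hN0
  -- the sign
  have hs₀ := twistSign_eq_one_or D bX Ψ y₁
  have Hs₀ := twistSign_global_at hlink D bX Ψ hpage hqc' hflat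
  have hsZ : (if decide (twistSign D bX Ψ y₁ = 1) then (-1 : ℤ) else 1) = -twistSign D bX Ψ y₁ := by
    rcases hs₀ with h1 | h1 <;> simp [h1]
  have hsR : (if decide (twistSign D bX Ψ y₁ = 1) then (1 : ℝ) else -1) = (twistSign D bX Ψ y₁ : ℝ) := by
    rcases hs₀ with h1 | h1 <;> simp [h1]
  -- the `jA`-bridge of the transport: `D₂p.jA (S_1 p) = D₂.jA p`
  have bridge : ∀ (p : Base g)
      (hp : p ∈ coresComplement (fun j : Fin N.length => dualMap D bX (bBase g) Ψ col κ δ hκ hκ1 hδ hδ2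
        (Fin.cast List.length_append.symm (Fin.natAdd P.length j))))
      (hp' : (strIso g m hm).toFun 1 p ∈ coresComplement (fun j : Fin N.length =>
        (dualMap D bX (bBase g) Ψ col κ δ hκ hκ1 hδ hδ2
          (Fin.cast List.length_append.symm (Fin.natAdd P.length j))).transport ((strIso g m hm).toDiffeomorph 1))),
      D₂p.jA ⟨(strIso g m hm).toFun 1 p, hp'⟩ = D₂.jA ⟨p, hp⟩ := by
    intro p hp hp'
    rw [hjA]
    congr 1
    apply Subtype.ext
    rw [HgapTransport.coe_coresComplementCongr_str]
    exact str_left_inv m hm p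
  -- side-2 membership of seam images
  have hmem₂ : ∀ (y' : (bBase g).carrier) (hy' : (y'.1 : Base g) ∈ coresComplement h),
      seamB D bX Ψ y' ∈ coresComplement (fun j : Fin N.length => dualMap D bX (bBase g) Ψ col κ δ hκ hκ1 hδ hδ2
        (Fin.cast List.length_append.symm (Fin.natAdd P.length j))) := fun y' hy' =>
    incl_mem_coresComplement_dualMap D bX (bBase g) Ψ col κ δ hκ hκ1 hδ hδ2
      (fun j : Fin N.length => Fin.cast List.length_append.symm (Fin.natAdd P.length j)) (seamLift D bX Ψ y')
      ⟨y'.1, hy'⟩ (incl_seamLift D bX Ψ hy').symm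
  have hmem₂' : ∀ (y' : (bBase g).carrier) (hy' : (y'.1 : Base g) ∈ coresComplement h),
      (strIso g m hm).toFun 1 (seamB D bX Ψ y') ∈ coresComplement (fun j : Fin N.length =>
        (dualMap D bX (bBase g) Ψ col κ δ hκ hκ1 hδ hδ2
          (Fin.cast List.length_append.symm (Fin.natAdd P.length j))).transport ((strIso g m hm).toDiffeomorph 1)) :=
    fun y' hy' => apply_mem_coresComplement_transport _ ((strIso g m hm).toDiffeomorph 1) (hmem₂ y' hy')
  -- side 1: the seam point `y₀` over `q`
  have hb₁ : D₁.jA ⟨q, hqP⟩ ∈ (𝓡∂ 4).boundary X₁ := (isBoundaryPoint_jA_iff D₁ ⟨q, hqP⟩).2 y₁.2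
  haveI : Nonempty (BoundaryManifold.boundaryData 3 X₁).carrier := ⟨⟨D₁.jA ⟨q, hqP⟩, hb₁⟩⟩
  have hy₀ : (BoundaryManifold.boundaryData 3 X₁).incl ((BoundaryManifold.boundaryData 3 X₁).inclInv (D₁.jA ⟨q, hqP⟩)) =
      D₁.jA ⟨q, hqP⟩ := (BoundaryManifold.boundaryData 3 X₁).incl_inclInv hb₁
  -- the local seam formula over strictly shallow points near `q`
  have hloc : ∀ (y' : (bBase g).carrier) (hy' : (y'.1 : Base g) ∈ coresComplement h)
      (hy'P : (y'.1 : Base g) ∈ coresComplement (fun i : Fin P.length => h (Fin.cast List.length_append.symm (Fin.castAdd N.length i))))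
      (hsh : ∀ (j : Fin N.length) (t : ↥(handleTube 3 2)),
        (h (Fin.cast List.length_append.symm (Fin.natAdd P.length j))).toFun t = (y'.1 : Base g) →
        ‖lamPart ((t : closedBall (0 : EuclideanSpace ℝ (Fin 4)) 1) : EuclideanSpace ℝ (Fin 4))‖ ^ 2 ≤ 1 - 3 * κ ^ 2 / 4),
      b₂.incl (φ ((BoundaryManifold.boundaryData 3 X₁).inclInv (D₁.jA ⟨y'.1, hy'P⟩))) =
        D₂p.jA ⟨(strIso g m hm).toFun 1 (seamB D bX Ψ y'), hmem₂' y' hy'⟩ := by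
    intro y' hy' hy'P hsh
    have hb' : D₁.jA ⟨y'.1, hy'P⟩ ∈ (𝓡∂ 4).boundary X₁ := (isBoundaryPoint_jA_iff D₁ ⟨y'.1, hy'P⟩).2 y'.2
    have hinc : (BoundaryManifold.boundaryData 3 X₁).incl ((BoundaryManifold.boundaryData 3 X₁).inclInv (D₁.jA ⟨y'.1, hy'P⟩)) =
        D₁.jA ⟨y'.1, hy'P⟩ := (BoundaryManifold.boundaryData 3 X₁).incl_inclInv hb'
    rw [bridge (seamB D bX Ψ y') (hmem₂ y' hy') (hmem₂' y' hy')]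
    exact hseam _ ⟨y'.1, hy'⟩ hy'P (seamLift D bX Ψ y') (incl_seamLift D bX Ψ hy').symm hinc hsh
  -- shallowness at `q` and near `q`
  have hshq : ∀ (j : Fin N.length) (t : ↥(handleTube 3 2)),
      (h (Fin.cast List.length_append.symm (Fin.natAdd P.length j))).toFun t = (y₁.1 : Base g) →
      ‖lamPart ((t : closedBall (0 : EuclideanSpace ℝ (Fin 4)) 1) : EuclideanSpace ℝ (Fin 4))‖ ^ 2 ≤ 1 - 3 * κ ^ 2 / 4 :=
    fun j t ht => by rw [norm_lamPart_sq]; exact ((hM j t ht).trans hcM.le)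
  have hev := eventually_shallow (fun j : Fin N.length => h (Fin.cast List.length_append.symm (Fin.natAdd P.length j)))
    hcpos hcM hM
  refine ⟨fun j : Fin N.length => (dualMap D bX (bBase g) Ψ col κ δ hκ hκ1 hδ hδ2
      (Fin.cast List.length_append.symm (Fin.natAdd P.length j))).transport ((strIso g m hm).toDiffeomorph 1),
    D₂p, decide (twistSign D bX Ψ y₁ = 1),
    fun j => ⟨pageDir (P ++ N).length (P.length + j), norm_pageDir _ _, hpages j⟩, hshadows, fun j => ?_,
    ⟨(BoundaryManifold.boundaryData 3 X₁).inclInv (D₁.jA ⟨q, hqP⟩), ⟨q, hqP⟩,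
      ⟨(strIso g m hm).toFun 1 (seamB D bX Ψ y₁), hmem₂' y₁ hqc'⟩, hy₀, hloc y₁ hqc' hqP hshq, ?_⟩, R1p, R2p⟩
  · -- (B) the twisting clause
    have hB := HB g (P ++ N) h hlink D bX Ψ hpage (twistSign D bX Ψ y₁) hs₀ Hs₀ col κ δ hκ hκ1 hδ hδ2
      (Fin.cast List.length_append.symm (Fin.natAdd P.length j)) (pageDir (P ++ N).length (P.length + j))
      (norm_pageDir _ _) (strIso g m hm) (str_rho_base m hm) (str_dir_base m hm) (fun θ => hpages j θ)
    rw [hB, hsZ, get_append_natAdd, hNs _ (List.get_mem N j)]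
    simp
  · -- (C) the orientation character
    intro uu v₁ v₂ hF1 hF2 hpos
    rw [hsR]
    refine Hgap_character D bX Ψ hpage D₁ (BoundaryManifold.boundaryData 3 X₁) D₂p b₂ φ (strIso g m hm)
      (str_rho_base m hm) y₁ hqc' hflat ⟨q, hqP⟩ rfl _ hy₀ _ rfl ?_ uu v₁ v₂ hF1 hF2 hpos
    -- the local seam formula near `y₁`
    have hopen : ∀ᶠ y' in 𝓝 y₁, (y'.1 : Base g) ∈ coresComplement h := isOpen_seamDom.mem_nhds hqc'
    have hev' : ∀ᶠ y' : (bBase g).carrier in 𝓝 y₁, ∀ (j : Fin N.length) (t : ↥(handleTube 3 2)),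
        (h (Fin.cast List.length_append.symm (Fin.natAdd P.length j))).toFun t = (y'.1 : Base g) →
        lamSq 2 ((t : closedBall (0 : EuclideanSpace ℝ (Fin 4)) 1) : EuclideanSpace ℝ (Fin 4)) < 1 - 3 * κ ^ 2 / 4 :=
      (continuous_subtype_val.continuousAt (x := y₁)).eventually hev
    filter_upwards [hopen, hev'] with y' hy' hsh'
    have hy'P : (y'.1 : Base g) ∈ coresComplement (fun i : Fin P.length => h (Fin.cast List.length_append.symm (Fin.castAdd N.length i))) :=
      (mem_coresComplement _).2 fun i => (mem_coresComplement _).1 hy' _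
    exact ⟨hy'P, hmem₂' y' hy', hloc y' hy' hy'P fun j t ht => by
      rw [norm_lamPart_sq]; exact (hsh' j t ht).le⟩

/-! ## §5 The registered helper -/

/-- **Sub-goal `helper_exists_depth_bound` of stub `stub_T3_dualPresentation`** (T3 ▸ node `Hgap` ▸
assembly; wave 6, lead c5, worker G3): **a point off the cores of a finite family of attaching maps has
tube preimages of depth bounded away from `1`** (`exists_depth_bound`; the margin `κ₁` of `HgapK_of_HB`
comes from it). [cite: Kosinski1993, VI §6] -/
theorem helper_exists_depth_bound : ∀ (g : ℕ) (ι : Type) [Finite ι] (q : ι → Literature.Topology.FourManifolds.HandleAttachingMap 3 2 (Literature.Topology.FourManifolds.LefschetzBase.Base g)) (a : Literature.Topology.FourManifolds.LefschetzBase.Base g), a ∈ Literature.Topology.FourManifolds.HandleAttachingMap.coresComplement q → ∃ M : ℝ, 0 ≤ M ∧ M < 1 ∧ ∀ (i : ι) (t : ↥(Literature.Topology.FourManifolds.handleTube 3 2)), (q i).toFun t = a → Literature.Topology.FourManifolds.lamSq 2 ((t : Metric.closedBall (0 : EuclideanSpace ℝ (Fin 4)) 1) : EuclideanSpace ℝ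 (Fin 4)) ≤ M :=
  fun _ _ _ q _ ha => exists_depth_bound q ha

end Summit.SmoothPoincare4.SmoothPoincare4.Theorems.AcyclicBisectionExists.ModpBraidOrbits

end
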